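/-
Copyright (c) 2026 the pub-hodgecm-mathlib formalisation cell (harness21).  R90-TF SLAB, section S10 (Rogawski 1990, §13.8 read at `v`),
prover R90-C138-p05 (g2) — DEAL #81 (dealer R90-C138-plan (g4), 2026-09-05T03:27:21Z): the A2a₂ DRESS REHEARSAL = ★ p864804 `realiseH₂_of_letters`
with blocks C and D DISCHARGED by ★ names and letters A ∕ F read through their ★ named forms; h413 = `stmt-HodgeConjecture-24833`, route `HCCMUnconditional`.
-/
import Summits.HodgeConjecture.HodgeConjecture.Theorems.R90S10RealiseH2OfLetters             -- ★ p864804 (R90-C138-p01 (g0), DEAL #44): `realiseH₂_of_letters (AT) (hE) (hT2) (hA) (hB) (hC) (hD) (hF)`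
import Summits.HodgeConjecture.HodgeConjecture.Theorems.R90S10RealiseH2ResidualLettersDefs2   -- ★ p864837 (R90-C138-p02 (g2), DEAL #60): `GlobaliseRho₂Letter AT` (L-A), `ArchPacketLinkLetter AT` (L-F) + `_iff` (`Iff.rfl`)
import Summits.HodgeConjecture.HodgeConjecture.Theorems.R90S10FlathBlockDOfExists            -- ★ p864864 (R90-C138-p01 (g0), DEAL #63 (ii)): `flathBlockD_of_exists_flathBlockH` = letter D, PAID
import Summits.HodgeConjecture.HodgeConjecture.Theorems.R90S10ThetaBlockCOfTorusCharExtend   -- ★ p865044 (R90-C138-p05 (g2), DEAL #67): `thetaBlockC_holds` = letter C, PAID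
import Summits.HodgeConjecture.HodgeConjecture.Theorems.R90S10Row2H2OfLetters                 -- ★ (K2E3-p21 (g10), DEAL #73): `U2LinkedFibreFiniteLetter`, `U2MultOneLetter`, `row2H₂_of_letters` = letter B from two classed Ch. 11 letters
import HarnessLib

/-!
# R90-TF · S10 (Rogawski 1990 §13.8) · THEOREMS — `R90S10RealiseH2OfLettersDressed`: THE A2a₂ PAYER WITH BLOCKS C AND D DISCHARGED — `realiseH₂_dressed`

Cell hodgecm-mathlib, slab R90-TF, section S10 = §13.8 Prop. 13.8.3 (proof, p. 218 L8–L28, p. 219 L1–L3), crux item h413 = stmt-HodgeConjecture-24833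
(route `route-HodgeConjecture-HCCMUnconditional`).  Prover seat R90-C138-p05 (g2), DEAL #81 («KERNEL JUNCTION + A2a₂ DRESS REHEARSAL»).

WHAT.  ★ p864804 `realiseH₂_of_letters (AT) (hE) (hT2) (hA) (hB) (hC) (hD) (hF)` pays the socket body of `sock_S10_realiseH₂ : RealiseH₂Letter R90.S2.CuspG₀ R90.S2.CuspH₀`
(a global `H`-datum `𝔥 : S10HDatum₂ …` realising `ρ₀` at `v`) from the TELESCOPE of letters E → T2 → A → B → C → D → F.  Since then two letters were PAID in house —
C (the `U(Φ₁)`-line pinned at `v`, unramified off `v`, with its global class, archimedean component and trace pin: ★ p865044 `thetaBlockC_holds`, over the torus extension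
★ p864932 and the Euler∕trace-pin bricks ★ p864900∕p864901∕p864958∕p864966) and D (Flath on `H` at the standard levels: ★ p864864 `flathBlockD_of_exists_flathBlockH` over
★ p864731) — and letters A (globalisation of `ρ₀`, EXT-class) and F (the link law, XL) received ★ NAMES (★ p864837 `GlobaliseRho₂Letter AT` ∕ `ArchPacketLinkLetter AT`,
bodies = the binder bytes, `_iff := Iff.rfl`).  THIS FILE is the resulting ONE-NAME term:
`realiseH₂_dressed (AT) (hE) (hT2) (hA : GlobaliseRho₂Letter AT) (hB : ‹letter B by value›) (hF : ArchPacketLinkLetter AT) : ‹the conclusion of ★ p864804, verbatim›`,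
so that Lines A's socket body reads `realiseH₂_dressed AT sock_E R90.S2.stub_R90_S2_archBlockPacketCusp sock_A sock_S10_row2H₂LB sock_F` — ONE ★ name applied to named sockets.
It is at the same time the KERNEL JUNCTION CERTIFICATE that ★ `thetaBlockC_holds` and ★ `flathBlockD_of_exists_flathBlockH` land on the `hC` ∕ `hD` slots (the term
elaborates against ★ p864804's binders).

BINDERS KEPT (honest): `AT` (the abstract archimedean-type token, ★ p864804 :85–:87 verbatim), `hE` (the archimedean measure frame = T2's premises, :88–:105 verbatim;
S2∕S6 desks), `hT2` (S2's archimedean block packet letter BY VALUE, :106–:142 verbatim — its Lines-side name `R90.S2.stub_R90_S2_archBlockPacketCusp` is a `Cruxes/…/Lines`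
declaration which a Theorems file may not import, LAW L9), `hA`, `hB` (the `H`-side cut, :172–:190 verbatim; E1-class) — and, in the second head `realiseH₂_dressed₂`, the two classed Ch. 11 letters `hB₁`∕`hB₂` of ★ `row2H₂_of_letters` (K2E3-p21, DEAL #73) in its place, `hF`.  The conclusion is ★ p864804's (:300–:336) byte-for-byte (= the body of Lines A's
`RealiseH₂Letter` at `R90.S2.CuspG₀ ∕ R90.S2.CuspH₀`, which also lives in Lines and therefore enters by value).  All statement bytes are GENERATED from the tree copy of
★ p864804 by script (no hand edits), so the junctions are byte-identical by construction.

PRINT → PROOF: nothing new — `realiseH₂_of_letters AT hE hT2 ((globaliseRho₂Letter_iff AT).1 hA) hB thetaBlockC_holds flathBlockD_of_exists_flathBlockH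
((archPacketLinkLetter_iff AT).1 hF)`.  [Rogawski1990, §13.8 Prop. 13.8.3 (proof) p. 218 L8–L28, p. 219 L1–L3.]

CONTENTS: TWO theorems `realiseH₂_dressed` (letter B by value) and `realiseH₂_dressed₂` (letter B through ★ `row2H₂_of_letters`) (no `def`, no `instance`, no `notation`, no `sorry`; axioms ⊆ {propext, Classical.choice, Quot.sound}).

HONEST LABEL: a dress rehearsal PAYS NOTHING NEW — it re-packages ★ p864804 with C and D discharged; the socket `sock_S10_realiseH₂` still waits on E (S2∕S6 archimedean
frame), T2 (S2), A (EXT: Langlands' globalisation [Langlands1983, p. 227]), B (E1-class: finiteness + multiplicity one on `U(2)`, [Rogawski1990, Thm. 11.5.1, Prop. 11.2.1])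
and F (XL: the Flath split over the packet cut); HC_CM is proved only modulo the 7 printed citations (2 remaining named inputs: hLiu418 = stmt-HodgeConjecture-24832,
h413 = stmt-HodgeConjecture-24833) until rung 0 closes; count-neutral helper; REL ≠ ★ ≠ WRITTEN ≠ BUILT.  Namespace `Summit.HodgeConjecture.HodgeConjecture.R90.S10`.

## References
* [Rogawski1990] J. D. Rogawski, *Automorphic Representations of Unitary Groups in Three Variables*, Ann. of Math. Stud. 123 (1990), §13.8 Prop. 13.8.3 (proof)
  p. 218 L8–L28, p. 219 L1–L3; §11.2 Prop. 11.2.1 p. 161; Thm. 11.5.1 p. 165; §12.3 Prop. 12.3.2 p. 178.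
* [Langlands1983] R. P. Langlands, *Les débuts d'une formule des traces stable*, Publ. Math. Univ. Paris VII 13 (1983), p. 227.
* [FlathCorvallis1979] D. Flath, *Decomposition of representations into tensor products*, PSPM 33.1 (1979), Thm. 3–4.
-/

set_option autoImplicit false
-- the mandated namespace repeats the single-problem summit's segment (`HodgeConjecture.HodgeConjecture`)
set_option linter.dupNamespace false

noncomputable section

open scoped RestrictedProduct Matrix MatrixGroups InnerProductSpace
open Filter MeasureTheory NumberField IsDedekindDomain CompactlySupported
open Literature.NumberTheory.Rogawski1990 Literature.NumberTheory.Automorphic Literature.NumberTheory.Automorphic.UnitaryGroup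
open Literature.NumberTheory.Automorphic.UnitaryGroup.CotangentForms Literature.NumberTheory.GaloisRepresentations
open Literature.NumberTheory.Automorphic.Arthur2013.Leaves.TECR
open Summit.HodgeConjecture.HodgeConjecture.Cruxes.H413.F0P3GlobalPacketDiscrete (cmOccursInDiscreteSpectrum)
open Summit.HodgeConjecture.HodgeConjecture.Cruxes.H413.K2E1TraceFormulaBeta
open Summit.HodgeConjecture.HodgeConjecture.Cruxes.H413.K2E1SpectralTermsDiscreteHalf
open Summit.HodgeConjecture.HodgeConjecture.Cruxes.H413.K2E1bGKCohomologyU21.U8 (HasArchOpTrace)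
open Summit.HodgeConjecture.HodgeConjecture.R90.S2 (CuspG₀ CuspH₀)

namespace Summit.HodgeConjecture.HodgeConjecture.R90.S10

/-- **THE A2a₂ PAYER, DRESSED — `realiseH₂_dressed`**: the conclusion of ★ `realiseH₂_of_letters` (a global `H`-datum `𝔥 : S10HDatum₂ …` over S2's cuspidality pins
`R90.S2.CuspG₀ ∕ R90.S2.CuspH₀` realising `ρ₀` at `v` with control embeddings `ι₁ ≠ ι₂`, under ⟪P⟫ ⟪U⟫ `h3` and the (13.8.3) frame at `v`) FROM the archimedean-type
token `AT`, the archimedean frame `hE`, S2's block packet letter `hT2` (by value), the globalisation letter `hA : GlobaliseRho₂Letter AT` (★ name), the `H`-side cut `hB` (by value, ★ p864804 :172–:190 verbatim; E1-class)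
and the link law `hF : ArchPacketLinkLetter AT` (★ name) — letters C and D being DISCHARGED by ★ `thetaBlockC_holds` and ★ `flathBlockD_of_exists_flathBlockH`.
[cite: Rogawski1990, §13.8 Prop. 13.8.3 (proof) p. 218 L8–L28, p. 219 L1–L3; §11.2 Prop. 11.2.1 p. 161; Thm. 11.5.1 p. 165] [cite: FlathCorvallis1979, Thm. 3–4] -/
theorem realiseH₂_dressed
    (AT : ∀ (L : Type) [Field L] [NumberField L] [IsCMField L] [MeasurableSpace (H2 L).Adelic] [BorelSpace (H2 L).Adelic]
      (μH : Measure (H2 L).automorphicQuotient) [(H2 L).IsAutomorphicMeasure μH], DiscreteAutomorphicRep (H2 L) μH →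
      ∀ (EH : Type) [NormedAddCommGroup EH] [InnerProductSpace ℂ EH] [CompleteSpace EH], ContRepresentation ℂ (HArch L) EH → Prop)
    (hE : ∀ (L : Type) [Field L] [NumberField L] [IsCMField L] (μ : HeckeCharacter L)
      [MeasurableSpace (GArch L)] [BorelSpace (GArch L)] [MeasurableSpace (HArch L)] [BorelSpace (HArch L)],
      μ.IsUnitary →
      (∀ x : Literature.NumberTheory.GaloisRepresentations.ideleGroup ↥(maximalRealSubfield L),
        μ (AdeleRing.ideleBaseChange (↥(maximalRealSubfield L)) L x) = quadraticHeckeCharCM L x) →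
      ∃ (νGi : Measure (GArch L)) (_ : νGi.IsHaarMeasure) (_ : νGi.IsMulRightInvariant) (νHi : Measure (HArch L)) (_ : νHi.IsHaarMeasure) (_ : νHi.IsMulRightInvariant) (tGi : ∀ γ : GArch L, Measure (Subgroup.centralizer ({γ} : Set (GArch L)))) (tHi : ∀ a : HArch L, Measure (Subgroup.centralizer ({a} : Set (HArch L)))) (mGi : ArchOrbFamG L) (mHi : ArchOrbFamH L),
        (letI : ∀ γ : GArch L, MeasurableSpace (GArch L ⧸ Subgroup.centralizer ({γ} : Set (GArch L))) := fun _ => borel _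
    haveI : ∀ γ : GArch L, BorelSpace (GArch L ⧸ Subgroup.centralizer ({γ} : Set (GArch L))) := fun _ => ⟨rfl⟩
    mGi.IsQuotientOf (fun γ => IsRegularElt (γ.val : GL (Fin 3) (mixedEmbedding.mixedSpace L))) νGi tGi) ∧
        (∀ (γ₁ γ₂ : GArch L)
            (h₁ : IsRegularElt (γ₁.val : GL (Fin 3) (mixedEmbedding.mixedSpace L)))
            (hc : Corresponds (UnitaryGroup.conjMixed (↥(maximalRealSubfield L)) L (IsCMField.complexConj L))
              (UnitaryGroup.archFormOf L 3 (phi3 L)) (UnitaryGroup.archFormOf L 3 (phi3 L)) γ₁ γ₂),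
            Measure.map ⇑(UnitaryGroup.archStableCentralizerEquiv L (UnitaryGroup.isUnit_antidiagOne_det L 3).ne_zero
              (UnitaryGroup.isUnit_antidiagOne_det L 3).ne_zero hc h₁) (tGi γ₁) = tGi γ₂) ∧
        ArchCompatibleFamiliesH L νHi mHi tHi tGi ∧
        IsArchNondegenerate L (phi3 L) (archDeltaPP L μ) ∧
        IsArchDeltaTransferExists L (phi3 L) (archDeltaPP L μ) mHi mGi (ArchSmooth L 3 (phi3 L)) (ArchSmooth₂ L))
    (hT2 :
      ∀ (L : Type) [Field L] [NumberField L] [IsCMField L] (μ : HeckeCharacter L)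
        [MeasurableSpace (GInf L)] [BorelSpace (GInf L)] (ν : Measure (GInf L)) [ν.IsHaarMeasure] [ν.IsMulRightInvariant]
        [MeasurableSpace (HInf L)] [BorelSpace (HInf L)] (νH : Measure (HInf L)) [νH.IsHaarMeasure] [νH.IsMulRightInvariant],
      letI : ∀ a : HInf L, MeasurableSpace (HInf L ⧸ Subgroup.centralizer ({a} : Set (HInf L))) := fun _ => borel _
      haveI : ∀ a : HInf L, BorelSpace (HInf L ⧸ Subgroup.centralizer ({a} : Set (HInf L))) := fun _ => ⟨rfl⟩
      letI : ∀ γ : GInf L, MeasurableSpace (GInf L ⧸ Subgroup.centralizer ({γ} : Set (GInf L))) := fun _ => borel _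
      haveI : ∀ γ : GInf L, BorelSpace (GInf L ⧸ Subgroup.centralizer ({γ} : Set (GInf L))) := fun _ => ⟨rfl⟩
      ∀ (mH : OrbitalMeasureFamily (HInf L)) (mG : OrbitalMeasureFamily (GInf L))
        (tH : ∀ a : HInf L, Measure (Subgroup.centralizer ({a} : Set (HInf L))))
        (t : ∀ γ : GInf L, Measure (Subgroup.centralizer ({γ} : Set (GInf L)))),
        mG.IsQuotientOf (fun γ => IsRegularElt (γ.val : GL (Fin 3) (mixedEmbedding.mixedSpace L))) ν t →
        (∀ (γ₁ γ₂ : GInf L)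
            (h₁ : IsRegularElt (γ₁.val : GL (Fin 3) (mixedEmbedding.mixedSpace L)))
            (hc : Corresponds (UnitaryGroup.conjMixed (↥(maximalRealSubfield L)) L (IsCMField.complexConj L))
              (UnitaryGroup.archFormOf L 3 (phi3 L)) (UnitaryGroup.archFormOf L 3 (phi3 L)) γ₁ γ₂),
            Measure.map ⇑(UnitaryGroup.archStableCentralizerEquiv L (UnitaryGroup.isUnit_antidiagOne_det L 3).ne_zero
              (UnitaryGroup.isUnit_antidiagOne_det L 3).ne_zero hc h₁) (t γ₁) = t γ₂) →
        ArchCompatibleFamiliesH L νH mH tH t →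
        IsArchNondegenerate L (phi3 L) (archDeltaPP L μ) →
        IsArchDeltaTransferExists L (phi3 L) (archDeltaPP L μ) mH mG (ArchSmooth L 3 (phi3 L)) (ArchSmooth₂ L) →
          ∃ (κ : Type) (_ : Fintype κ) (_ : DecidableEq κ)
            (EG : κ → Type) (_ : ∀ k, NormedAddCommGroup (EG k)) (_ : ∀ k, InnerProductSpace ℂ (EG k)) (_ : ∀ k, CompleteSpace (EG k))
            (ϖ : ∀ k, ContRepresentation ℂ (GInf L) (EG k)) (hu : ∀ k, (ϖ k).IsUnitary) (hsc : ∀ k, (ϖ k).IsStronglyContinuous)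
            (_ : ∀ k, (ϖ k).IsTopIrreducible)
            (f : κ → C_c(GInf L, ℂ)) (_ : ∀ k, ArchSmooth L 3 (phi3 L) ⇑(f k))
            (_ : ∀ k k', HasArchOpTrace ν (ϖ k) (hu k) (hsc k) (f k') (if k = k' then 1 else 0))
            (_ : ∀ (E : Type) [NormedAddCommGroup E] [InnerProductSpace ℂ E] [CompleteSpace E]
                (π : ContRepresentation ℂ (GInf L) E) (hπu : π.IsUnitary) (hπsc : π.IsStronglyContinuous), π.IsTopIrreducible →
                (∀ k, ¬ ContRepresentation.AreUnitarilyEquivalent (ϖ k) π) → ∀ k, HasArchOpTrace ν π hπu hπsc (f k) 0)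
            (s : κ → ℤ) (_ : ∀ k, s k = 1 ∨ s k = -1) (_ : ∃ k k', s k ≠ s k')
            (EH : Type) (_ : NormedAddCommGroup EH) (_ : InnerProductSpace ℂ EH) (_ : CompleteSpace EH)
            (ρ : ContRepresentation ℂ (HInf L) EH) (huH : ρ.IsUnitary) (hscH : ρ.IsStronglyContinuous),
            IsArchEndoCharId L (archDeltaPP L μ) mH mG ν νH EG ϖ hu hsc s ρ huH hscH ∧
            ∃ k₁ k₂ : κ, s k₁ = 1 ∧ s k₂ = -1 ∧ (∀ ι : L →+* ℂ, CuspG₀ L mG ι ⇑(f k₁ - f k₂)) ∧ IsArchStablyNull L mG ⇑(f k₁ - f k₂) ∧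
              ∃ fH : C_c(HInf L, ℂ), ArchSmooth₂ L ⇑fH ∧ IsArchDeltaTransfer L (phi3 L) (archDeltaPP L μ) mH mG ⇑fH ⇑(f k₁ - f k₂) ∧
                ∀ ι : L →+* ℂ, CuspH₀ L mH ι ⇑fH)
    (hA : GlobaliseRho₂Letter AT)
    (hB : ∀ (L : Type) [Field L] [NumberField L] [IsCMField L] [DecidableEq (Pl L)] (μ : HeckeCharacter L) (v : Pl L)
      [MeasurableSpace (HLoc L v)] [BorelSpace (HLoc L v)] [MeasurableSpace (Gqs L v)] [BorelSpace (Gqs L v)]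
      (νHv : Measure (HLoc L v)) (νQv : Measure (Gqs L v)) [νHv.IsHaarMeasure] [νHv.IsMulRightInvariant] [νQv.IsHaarMeasure] [νQv.IsMulRightInvariant]
      [∀ a : HLoc L v, MeasurableSpace (HLoc L v ⧸ Subgroup.centralizer ({a} : Set (HLoc L v)))]
      [∀ a : HLoc L v, BorelSpace (HLoc L v ⧸ Subgroup.centralizer ({a} : Set (HLoc L v)))]
      [∀ γ : Gqs L v, MeasurableSpace (Gqs L v ⧸ Subgroup.centralizer ({γ} : Set (Gqs L v)))]
      [∀ γ : Gqs L v, BorelSpace (Gqs L v ⧸ Subgroup.centralizer ({γ} : Set (Gqs L v)))]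
      (mHv : OrbitalMeasureFamily (HLoc L v)) (mQv : OrbitalMeasureFamily (Gqs L v)) (πSt : IrrClass (HLoc L v))
      [MeasurableSpace (G3 L).Adelic] [BorelSpace (G3 L).Adelic] [MeasurableSpace (H2 L).Adelic] [BorelSpace (H2 L).Adelic]
      [MeasurableSpace (GArch L)] [BorelSpace (GArch L)] [MeasurableSpace (HArch L)] [BorelSpace (HArch L)]
      [MeasurableSpace (H1Loc L v)] [BorelSpace (H1Loc L v)] [MeasurableSpace (H1Arch L)] [BorelSpace (H1Arch L)]
      [MeasurableSpace (H1 L).Adelic] [BorelSpace (H1 L).Adelic],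
      ∀ (μH : Measure (H2 L).automorphicQuotient) [(H2 L).IsAutomorphicMeasure μH] (νH : Measure (H2 L).Adelic) [νH.IsHaarMeasure] (PH : DiscreteAutomorphicRep (H2 L) μH) (ρ₂ : ∀ w : Pl L, IrrClass (H2Loc L w)) (WfH : Type) [AddCommGroup WfH] [Module ℂ WfH] (σfH : Representation ℂ (finAdelic (↥(maximalRealSubfield L)) L (IsCMField.complexConj L) 2 (Matrix.of fun i j : Fin 2 => if i.val + j.val + 1 = 2 then (1 : L) else 0)) WfH) (hPσfH : PH.HasFinComponent σfH) (hσfH : HasLocalClasses L 2 (Matrix.of fun i j : Fin 2 => if i.val + j.val + 1 = 2 then (1 : L) else 0) σfH ρ₂),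
      ∃ (J : Type) (_ : Finite J) (dρ : J → DiscreteClass (H2 L) μH),
        Function.Injective dρ ∧
        DiscreteClass.mk PH ∈ Set.range dρ ∧
        (∀ j, IsLinked L 2 (Matrix.of fun i j : Fin 2 => if i.val + j.val + 1 = 2 then (1 : L) else 0) μH (dρ j) ρ₂) ∧
        (∀ j, (dρ j).mult = 1) ∧
        ∀ d : DiscreteClass (H2 L) μH, IsLinked L 2 (Matrix.of fun i j : Fin 2 => if i.val + j.val + 1 = 2 then (1 : L) else 0) μH d ρ₂ → d ∈ Set.range dρ)
    (hF : ArchPacketLinkLetter AT) :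
    ∀ (L : Type) [Field L] [NumberField L] [IsCMField L] (μ : HeckeCharacter L) (ξ : OneDimAutRepH L) (v : Pl L),
      (∀ w : PlacesOver L v, IsCMField.complexConj L • w.1 = w.1) → μ.IsUnitary →
      (∀ x : Literature.NumberTheory.GaloisRepresentations.ideleGroup ↥(maximalRealSubfield L),
        μ (AdeleRing.ideleBaseChange (↥(maximalRealSubfield L)) L x) = quadraticHeckeCharCM L x) →
      (∀ w : Pl L, w ≠ v → ∀ W : PlacesOver L w, Algebra.IsUnramifiedAt (𝓞 ↥(maximalRealSubfield L)) W.1.asIdeal ∧ μ.IsUnramifiedAt W.1) →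
      (3 ≤ Module.finrank ℚ ↥(maximalRealSubfield L)) →
      ∀ [MeasurableSpace (HLoc L v)] [BorelSpace (HLoc L v)] [MeasurableSpace (Gqs L v)] [BorelSpace (Gqs L v)]
        (νHv : Measure (HLoc L v)) (νQv : Measure (Gqs L v))
        [νHv.IsHaarMeasure] [νHv.IsMulRightInvariant] [νQv.IsHaarMeasure] [νQv.IsMulRightInvariant],
      letI : ∀ a : HLoc L v, MeasurableSpace (HLoc L v ⧸ Subgroup.centralizer ({a} : Set (HLoc L v))) := fun _ => borel _
      haveI : ∀ a : HLoc L v, BorelSpace (HLoc L v ⧸ Subgroup.centralizer ({a} : Set (HLoc L v))) := fun _ => ⟨rfl⟩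
      letI : ∀ γ : Gqs L v, MeasurableSpace (Gqs L v ⧸ Subgroup.centralizer ({γ} : Set (Gqs L v))) := fun _ => borel _
      haveI : ∀ γ : Gqs L v, BorelSpace (Gqs L v ⧸ Subgroup.centralizer ({γ} : Set (Gqs L v))) := fun _ => ⟨rfl⟩
      ∀ (mHv : OrbitalMeasureFamily (HLoc L v)) (mQv : OrbitalMeasureFamily (Gqs L v)),
        mHv.IsCanonical (IsLocalGRegular L v) νHv →
        mQv.IsCanonical (fun γ => IsRegularElt (γ.val : GL (Fin 3) (UnitaryGroup.LocalRing L v))) νQv →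
        ∀ (π₁ πSt : IrrClass (HLoc L v)),
          HLengthTwoLabels L v
            (torusCharPair (conjLocal L (IsCMField.complexConj L) v) (cmLocalForm L 2 v) (cmLocalForm_eq_over L 2 v) 0
              ((torusLocalComponent L (IsCMField.complexConj L) v ξ.η).comp
                  (quotConj (conjLocal L (IsCMField.complexConj L) v) (conjLocal_conjLocal_cm L v)) *
                halfModulusChar (UnitaryGroup.LocalRing L v))
              (torusLocalComponent L (IsCMField.complexConj L) v ξ.ψ))
            ((torusLocalComponent L (IsCMField.complexConj L) v ξ.ψ).comp (localDet (IsCMField.complexConj L) v (isUnit_antidiagOne_det L 1))) π₁ πSt →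
          (∀ fH : HLoc L v → ℂ, IsLocSmooth fH → π₁.smoothTrace νHv fH = charDist (ξ.xiLocalChar v) νHv fH) →
          ∀ [DecidableEq (Pl L)] [MeasurableSpace (G3 L).Adelic] [BorelSpace (G3 L).Adelic] [MeasurableSpace (H2 L).Adelic] [BorelSpace (H2 L).Adelic]
            [MeasurableSpace (GArch L)] [BorelSpace (GArch L)] [MeasurableSpace (HArch L)] [BorelSpace (HArch L)]
            [MeasurableSpace (H1Loc L v)] [BorelSpace (H1Loc L v)] [MeasurableSpace (H1Arch L)] [BorelSpace (H1Arch L)]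
            [MeasurableSpace (H1 L).Adelic] [BorelSpace (H1 L).Adelic],
          ∀ (ι₁ ι₂ : L →+* ℂ), NumberField.InfinitePlace.mk ι₁ ≠ NumberField.InfinitePlace.mk ι₂ →
          ∀ (ρ₀ : IrrClass ((UnitaryGroup.cmDatum L 2 (Matrix.of fun i j : Fin 2 => if i.val + j.val + 1 = 2 then (1 : L) else 0)).Local v))
            (hχ : IsOpen ((((torusLocalComponent L (IsCMField.complexConj L) v ξ.ψ).comp (localDet (IsCMField.complexConj L) v (isUnit_antidiagOne_det L 1))).ker : Subgroup ↥(UnitaryGroup.«local» L (IsCMField.complexConj L) 1 (Matrix.of fun i j : Fin 1 => if i.val + j.val + 1 = 1 then (1 : L) else 0) v)) : Set ↥(UnitaryGroup.«local» L (IsCMField.complexConj L) 1 (Matrix.of fun i j : Fin 1 => if i.val + j.val + 1 = 1 then (1 : L) else 0) v))),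
            ρ₀.IsAdmissible →
            (letI : MeasurableSpace ((UnitaryGroup.cmDatum L 2 (Matrix.of fun i j : Fin 2 => if i.val + j.val + 1 = 2 then (1 : L) else 0)).Local v ⧸ Subgroup.center ((UnitaryGroup.cmDatum L 2 (Matrix.of fun i j : Fin 2 => if i.val + j.val + 1 = 2 then (1 : L) else 0)).Local v)) := borel _
             ∃ μZ : Measure ((UnitaryGroup.cmDatum L 2 (Matrix.of fun i j : Fin 2 => if i.val + j.val + 1 = 2 then (1 : L) else 0)).Local v ⧸ Subgroup.center ((UnitaryGroup.cmDatum L 2 (Matrix.of fun i j : Fin 2 => if i.val + j.val + 1 = 2 then (1 : L) else 0)).Local v)), μZ.IsHaarMeasure ∧ ρ₀.IsSquareIntegrable μZ) →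
            IrrClass.boxChar ((torusLocalComponent L (IsCMField.complexConj L) v ξ.ψ).comp (localDet (IsCMField.complexConj L) v (isUnit_antidiagOne_det L 1))) hχ ρ₀ = πSt →
            ∃ 𝔥 : S10HDatum₂ L μ v νHv νQv mHv mQv πSt (R90.S2.CuspG₀ L) (R90.S2.CuspH₀ L), 𝔥.ρ₂ v = ρ₀ ∧ 𝔥.ι₁ = ι₁ ∧ 𝔥.ι₂ = ι₂ ∧ (Continuous 𝔥.χi ∧ IsFiniteMeasureOnCompacts 𝔥.ν₁i) :=
  realiseH₂_of_letters AT hE hT2 ((globaliseRho₂Letter_iff AT).1 hA) hB thetaBlockC_holds flathBlockD_of_exists_flathBlockH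
    ((archPacketLinkLetter_iff AT).1 hF)

/-- **THE A2a₂ PAYER, DRESSED TWICE — `realiseH₂_dressed₂`**: as `realiseH₂_dressed`, with letter B READ THROUGH ★ `row2H₂_of_letters` (K2E3-p21 (g10), DEAL #73)
from its two classed Ch. 11 letters `hB₁ : ∀ L μH, U2LinkedFibreFiniteLetter L μH` (the linked fibre of a discrete `ρ₂` on `U(Φ₂)` is finite,
[Rogawski1990, Thm. 11.5.1 (a)(b)]) and `hB₂ : ∀ L μH, U2MultOneLetter L μH` (multiplicity one on `U(Φ₂)`, [Rogawski1990, Prop. 11.2.1, Thm. 11.5.1 (c)]) — so that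
Lines A's socket body is ONE ★ name on named sockets: `realiseH₂_dressed₂ AT sock_E ‹T2› sock_A sock_B₁ sock_B₂ sock_F`.
[cite: Rogawski1990, §13.8 Prop. 13.8.3 (proof) p. 218 L8–L28, p. 219 L1–L3; §11.2 Prop. 11.2.1 p. 161; Thm. 11.5.1 p. 165] [cite: FlathCorvallis1979, Thm. 3–4] -/
theorem realiseH₂_dressed₂
    (AT : ∀ (L : Type) [Field L] [NumberField L] [IsCMField L] [MeasurableSpace (H2 L).Adelic] [BorelSpace (H2 L).Adelic]
      (μH : Measure (H2 L).automorphicQuotient) [(H2 L).IsAutomorphicMeasure μH], DiscreteAutomorphicRep (H2 L) μH →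
      ∀ (EH : Type) [NormedAddCommGroup EH] [InnerProductSpace ℂ EH] [CompleteSpace EH], ContRepresentation ℂ (HArch L) EH → Prop)
    (hE : ∀ (L : Type) [Field L] [NumberField L] [IsCMField L] (μ : HeckeCharacter L)
      [MeasurableSpace (GArch L)] [BorelSpace (GArch L)] [MeasurableSpace (HArch L)] [BorelSpace (HArch L)],
      μ.IsUnitary →
      (∀ x : Literature.NumberTheory.GaloisRepresentations.ideleGroup ↥(maximalRealSubfield L),
        μ (AdeleRing.ideleBaseChange (↥(maximalRealSubfield L)) L x) = quadraticHeckeCharCM L x) →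
      ∃ (νGi : Measure (GArch L)) (_ : νGi.IsHaarMeasure) (_ : νGi.IsMulRightInvariant) (νHi : Measure (HArch L)) (_ : νHi.IsHaarMeasure) (_ : νHi.IsMulRightInvariant) (tGi : ∀ γ : GArch L, Measure (Subgroup.centralizer ({γ} : Set (GArch L)))) (tHi : ∀ a : HArch L, Measure (Subgroup.centralizer ({a} : Set (HArch L)))) (mGi : ArchOrbFamG L) (mHi : ArchOrbFamH L),
        (letI : ∀ γ : GArch L, MeasurableSpace (GArch L ⧸ Subgroup.centralizer ({γ} : Set (GArch L))) := fun _ => borel _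
    haveI : ∀ γ : GArch L, BorelSpace (GArch L ⧸ Subgroup.centralizer ({γ} : Set (GArch L))) := fun _ => ⟨rfl⟩
    mGi.IsQuotientOf (fun γ => IsRegularElt (γ.val : GL (Fin 3) (mixedEmbedding.mixedSpace L))) νGi tGi) ∧
        (∀ (γ₁ γ₂ : GArch L)
            (h₁ : IsRegularElt (γ₁.val : GL (Fin 3) (mixedEmbedding.mixedSpace L)))
            (hc : Corresponds (UnitaryGroup.conjMixed (↥(maximalRealSubfield L)) L (IsCMField.complexConj L))
              (UnitaryGroup.archFormOf L 3 (phi3 L)) (UnitaryGroup.archFormOf L 3 (phi3 L)) γ₁ γ₂),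
            Measure.map ⇑(UnitaryGroup.archStableCentralizerEquiv L (UnitaryGroup.isUnit_antidiagOne_det L 3).ne_zero
              (UnitaryGroup.isUnit_antidiagOne_det L 3).ne_zero hc h₁) (tGi γ₁) = tGi γ₂) ∧
        ArchCompatibleFamiliesH L νHi mHi tHi tGi ∧
        IsArchNondegenerate L (phi3 L) (archDeltaPP L μ) ∧
        IsArchDeltaTransferExists L (phi3 L) (archDeltaPP L μ) mHi mGi (ArchSmooth L 3 (phi3 L)) (ArchSmooth₂ L))
    (hT2 :
      ∀ (L : Type) [Field L] [NumberField L] [IsCMField L] (μ : HeckeCharacter L)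
        [MeasurableSpace (GInf L)] [BorelSpace (GInf L)] (ν : Measure (GInf L)) [ν.IsHaarMeasure] [ν.IsMulRightInvariant]
        [MeasurableSpace (HInf L)] [BorelSpace (HInf L)] (νH : Measure (HInf L)) [νH.IsHaarMeasure] [νH.IsMulRightInvariant],
      letI : ∀ a : HInf L, MeasurableSpace (HInf L ⧸ Subgroup.centralizer ({a} : Set (HInf L))) := fun _ => borel _
      haveI : ∀ a : HInf L, BorelSpace (HInf L ⧸ Subgroup.centralizer ({a} : Set (HInf L))) := fun _ => ⟨rfl⟩
      letI : ∀ γ : GInf L, MeasurableSpace (GInf L ⧸ Subgroup.centralizer ({γ} : Set (GInf L))) := fun _ => borel _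
      haveI : ∀ γ : GInf L, BorelSpace (GInf L ⧸ Subgroup.centralizer ({γ} : Set (GInf L))) := fun _ => ⟨rfl⟩
      ∀ (mH : OrbitalMeasureFamily (HInf L)) (mG : OrbitalMeasureFamily (GInf L))
        (tH : ∀ a : HInf L, Measure (Subgroup.centralizer ({a} : Set (HInf L))))
        (t : ∀ γ : GInf L, Measure (Subgroup.centralizer ({γ} : Set (GInf L)))),
        mG.IsQuotientOf (fun γ => IsRegularElt (γ.val : GL (Fin 3) (mixedEmbedding.mixedSpace L))) ν t →
        (∀ (γ₁ γ₂ : GInf L)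
            (h₁ : IsRegularElt (γ₁.val : GL (Fin 3) (mixedEmbedding.mixedSpace L)))
            (hc : Corresponds (UnitaryGroup.conjMixed (↥(maximalRealSubfield L)) L (IsCMField.complexConj L))
              (UnitaryGroup.archFormOf L 3 (phi3 L)) (UnitaryGroup.archFormOf L 3 (phi3 L)) γ₁ γ₂),
            Measure.map ⇑(UnitaryGroup.archStableCentralizerEquiv L (UnitaryGroup.isUnit_antidiagOne_det L 3).ne_zero
              (UnitaryGroup.isUnit_antidiagOne_det L 3).ne_zero hc h₁) (t γ₁) = t γ₂) →
        ArchCompatibleFamiliesH L νH mH tH t →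
        IsArchNondegenerate L (phi3 L) (archDeltaPP L μ) →
        IsArchDeltaTransferExists L (phi3 L) (archDeltaPP L μ) mH mG (ArchSmooth L 3 (phi3 L)) (ArchSmooth₂ L) →
          ∃ (κ : Type) (_ : Fintype κ) (_ : DecidableEq κ)
            (EG : κ → Type) (_ : ∀ k, NormedAddCommGroup (EG k)) (_ : ∀ k, InnerProductSpace ℂ (EG k)) (_ : ∀ k, CompleteSpace (EG k))
            (ϖ : ∀ k, ContRepresentation ℂ (GInf L) (EG k)) (hu : ∀ k, (ϖ k).IsUnitary) (hsc : ∀ k, (ϖ k).IsStronglyContinuous)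
            (_ : ∀ k, (ϖ k).IsTopIrreducible)
            (f : κ → C_c(GInf L, ℂ)) (_ : ∀ k, ArchSmooth L 3 (phi3 L) ⇑(f k))
            (_ : ∀ k k', HasArchOpTrace ν (ϖ k) (hu k) (hsc k) (f k') (if k = k' then 1 else 0))
            (_ : ∀ (E : Type) [NormedAddCommGroup E] [InnerProductSpace ℂ E] [CompleteSpace E]
                (π : ContRepresentation ℂ (GInf L) E) (hπu : π.IsUnitary) (hπsc : π.IsStronglyContinuous), π.IsTopIrreducible →
                (∀ k, ¬ ContRepresentation.AreUnitarilyEquivalent (ϖ k) π) → ∀ k, HasArchOpTrace ν π hπu hπsc (f k) 0)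
            (s : κ → ℤ) (_ : ∀ k, s k = 1 ∨ s k = -1) (_ : ∃ k k', s k ≠ s k')
            (EH : Type) (_ : NormedAddCommGroup EH) (_ : InnerProductSpace ℂ EH) (_ : CompleteSpace EH)
            (ρ : ContRepresentation ℂ (HInf L) EH) (huH : ρ.IsUnitary) (hscH : ρ.IsStronglyContinuous),
            IsArchEndoCharId L (archDeltaPP L μ) mH mG ν νH EG ϖ hu hsc s ρ huH hscH ∧
            ∃ k₁ k₂ : κ, s k₁ = 1 ∧ s k₂ = -1 ∧ (∀ ι : L →+* ℂ, CuspG₀ L mG ι ⇑(f k₁ - f k₂)) ∧ IsArchStablyNull L mG ⇑(f k₁ - f k₂) ∧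
              ∃ fH : C_c(HInf L, ℂ), ArchSmooth₂ L ⇑fH ∧ IsArchDeltaTransfer L (phi3 L) (archDeltaPP L μ) mH mG ⇑fH ⇑(f k₁ - f k₂) ∧
                ∀ ι : L →+* ℂ, CuspH₀ L mH ι ⇑fH)
    (hA : GlobaliseRho₂Letter AT)
    (hB₁ : ∀ (L : Type) [Field L] [NumberField L] [IsCMField L] (μH : Measure (H2 L).automorphicQuotient) [(H2 L).IsAutomorphicMeasure μH],
      U2LinkedFibreFiniteLetter L μH)
    (hB₂ : ∀ (L : Type) [Field L] [NumberField L] [IsCMField L] (μH : Measure (H2 L).automorphicQuotient) [(H2 L).IsAutomorphicMeasure μH],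
      U2MultOneLetter L μH)
    (hF : ArchPacketLinkLetter AT) :
    ∀ (L : Type) [Field L] [NumberField L] [IsCMField L] (μ : HeckeCharacter L) (ξ : OneDimAutRepH L) (v : Pl L),
      (∀ w : PlacesOver L v, IsCMField.complexConj L • w.1 = w.1) → μ.IsUnitary →
      (∀ x : Literature.NumberTheory.GaloisRepresentations.ideleGroup ↥(maximalRealSubfield L),
        μ (AdeleRing.ideleBaseChange (↥(maximalRealSubfield L)) L x) = quadraticHeckeCharCM L x) →
      (∀ w : Pl L, w ≠ v → ∀ W : PlacesOver L w, Algebra.IsUnramifiedAt (𝓞 ↥(maximalRealSubfield L)) W.1.asIdeal ∧ μ.IsUnramifiedAt W.1) →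
      (3 ≤ Module.finrank ℚ ↥(maximalRealSubfield L)) →
      ∀ [MeasurableSpace (HLoc L v)] [BorelSpace (HLoc L v)] [MeasurableSpace (Gqs L v)] [BorelSpace (Gqs L v)]
        (νHv : Measure (HLoc L v)) (νQv : Measure (Gqs L v))
        [νHv.IsHaarMeasure] [νHv.IsMulRightInvariant] [νQv.IsHaarMeasure] [νQv.IsMulRightInvariant],
      letI : ∀ a : HLoc L v, MeasurableSpace (HLoc L v ⧸ Subgroup.centralizer ({a} : Set (HLoc L v))) := fun _ => borel _
      haveI : ∀ a : HLoc L v, BorelSpace (HLoc L v ⧸ Subgroup.centralizer ({a} : Set (HLoc L v))) := fun _ => ⟨rfl⟩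
      letI : ∀ γ : Gqs L v, MeasurableSpace (Gqs L v ⧸ Subgroup.centralizer ({γ} : Set (Gqs L v))) := fun _ => borel _
      haveI : ∀ γ : Gqs L v, BorelSpace (Gqs L v ⧸ Subgroup.centralizer ({γ} : Set (Gqs L v))) := fun _ => ⟨rfl⟩
      ∀ (mHv : OrbitalMeasureFamily (HLoc L v)) (mQv : OrbitalMeasureFamily (Gqs L v)),
        mHv.IsCanonical (IsLocalGRegular L v) νHv →
        mQv.IsCanonical (fun γ => IsRegularElt (γ.val : GL (Fin 3) (UnitaryGroup.LocalRing L v))) νQv →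
        ∀ (π₁ πSt : IrrClass (HLoc L v)),
          HLengthTwoLabels L v
            (torusCharPair (conjLocal L (IsCMField.complexConj L) v) (cmLocalForm L 2 v) (cmLocalForm_eq_over L 2 v) 0
              ((torusLocalComponent L (IsCMField.complexConj L) v ξ.η).comp
                  (quotConj (conjLocal L (IsCMField.complexConj L) v) (conjLocal_conjLocal_cm L v)) *
                halfModulusChar (UnitaryGroup.LocalRing L v))
              (torusLocalComponent L (IsCMField.complexConj L) v ξ.ψ))
            ((torusLocalComponent L (IsCMField.complexConj L) v ξ.ψ).comp (localDet (IsCMField.complexConj L) v (isUnit_antidiagOne_det L 1))) π₁ πSt →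
          (∀ fH : HLoc L v → ℂ, IsLocSmooth fH → π₁.smoothTrace νHv fH = charDist (ξ.xiLocalChar v) νHv fH) →
          ∀ [DecidableEq (Pl L)] [MeasurableSpace (G3 L).Adelic] [BorelSpace (G3 L).Adelic] [MeasurableSpace (H2 L).Adelic] [BorelSpace (H2 L).Adelic]
            [MeasurableSpace (GArch L)] [BorelSpace (GArch L)] [MeasurableSpace (HArch L)] [BorelSpace (HArch L)]
            [MeasurableSpace (H1Loc L v)] [BorelSpace (H1Loc L v)] [MeasurableSpace (H1Arch L)] [BorelSpace (H1Arch L)]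
            [MeasurableSpace (H1 L).Adelic] [BorelSpace (H1 L).Adelic],
          ∀ (ι₁ ι₂ : L →+* ℂ), NumberField.InfinitePlace.mk ι₁ ≠ NumberField.InfinitePlace.mk ι₂ →
          ∀ (ρ₀ : IrrClass ((UnitaryGroup.cmDatum L 2 (Matrix.of fun i j : Fin 2 => if i.val + j.val + 1 = 2 then (1 : L) else 0)).Local v))
            (hχ : IsOpen ((((torusLocalComponent L (IsCMField.complexConj L) v ξ.ψ).comp (localDet (IsCMField.complexConj L) v (isUnit_antidiagOne_det L 1))).ker : Subgroup ↥(UnitaryGroup.«local» L (IsCMField.complexConj L) 1 (Matrix.of fun i j : Fin 1 => if i.val + j.val + 1 = 1 then (1 : L) else 0) v)) : Set ↥(UnitaryGroup.«local» L (IsCMField.complexConj L) 1 (Matrix.of fun i j : Fin 1 => if i.val + j.val + 1 = 1 then (1 : L) else 0) v))),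
            ρ₀.IsAdmissible →
            (letI : MeasurableSpace ((UnitaryGroup.cmDatum L 2 (Matrix.of fun i j : Fin 2 => if i.val + j.val + 1 = 2 then (1 : L) else 0)).Local v ⧸ Subgroup.center ((UnitaryGroup.cmDatum L 2 (Matrix.of fun i j : Fin 2 => if i.val + j.val + 1 = 2 then (1 : L) else 0)).Local v)) := borel _
             ∃ μZ : Measure ((UnitaryGroup.cmDatum L 2 (Matrix.of fun i j : Fin 2 => if i.val + j.val + 1 = 2 then (1 : L) else 0)).Local v ⧸ Subgroup.center ((UnitaryGroup.cmDatum L 2 (Matrix.of fun i j : Fin 2 => if i.val + j.val + 1 = 2 then (1 : L) else 0)).Local v)), μZ.IsHaarMeasure ∧ ρ₀.IsSquareIntegrable μZ) →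
            IrrClass.boxChar ((torusLocalComponent L (IsCMField.complexConj L) v ξ.ψ).comp (localDet (IsCMField.complexConj L) v (isUnit_antidiagOne_det L 1))) hχ ρ₀ = πSt →
            ∃ 𝔥 : S10HDatum₂ L μ v νHv νQv mHv mQv πSt (R90.S2.CuspG₀ L) (R90.S2.CuspH₀ L), 𝔥.ρ₂ v = ρ₀ ∧ 𝔥.ι₁ = ι₁ ∧ 𝔥.ι₂ = ι₂ ∧ (Continuous 𝔥.χi ∧ IsFiniteMeasureOnCompacts 𝔥.ν₁i) :=
  realiseH₂_dressed AT hE hT2 hA (row2H₂_of_letters hB₁ hB₂) hF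

end Summit.HodgeConjecture.HodgeConjecture.R90.S10

end
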